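import Mathlib.Topology.UniformSpace.LocallyUniformConvergence
import Mathlib.Topology.MetricSpace.ProperSpace
import Mathlib.Analysis.InnerProductSpace.PiL2
import HarnessLib

/-!
# Compact boxes exhausting `ℝ × E` and limits of maps converging uniformly on them
# (crux `TypeIliouvilleNoTypeII`, stmt-NavierStokesRegularity-0056, line `Sketch`, stub
# `stub_activeWindowsGenerateNonconstant`)

Helper file (theorems only; general topology): the two-sided analogue of the slab pieces of the
tree's `Literature.Analysis.FluidPDE.HolderExtraction` (there `[−(n+2), −1/(n+2)] × B̄(0, n+2)`
exhaust the open slab `(−∞, 0) × E`; here the boxes `[−(n+1), n+1] × B̄(0, n+1)` exhaust all of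
`ℝ × E`). Every point is interior to all large boxes (`eventually_boxPiece_mem_nhds`), whence a map
converging uniformly on every box along eventually continuous maps has a continuous limit
(`continuous_of_tendstoUniformlyOn_boxPiece`), converging pointwise
(`tendsto_of_tendstoUniformlyOn_boxPiece`) and slice-wise locally uniformly
(`tendstoLocallyUniformly_slice_of_tendstoUniformlyOn_boxPiece`). Used by the diagonal
Arzelà–Ascoli extraction of the two-sided ("immortal") zoom of the line.
-/

noncomputable section

-- the summit and its single problem share the name (D-0017 nested layout)
set_option linter.dupNamespace false

open Set Function Filter Topology Metric

namespace Summit.NavierStokesRegularity.NavierStokesRegularity.Theorems.TypeIliouvilleNoTypeII.ImmortalZoom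

/-! ### Compact boxes exhausting `ℝ × E` -/

section Box

variable {E : Type*} [NormedAddCommGroup E]

/-- Membership in the box `[−(n+1), n+1] × B̄(0, n+1)`, unfolded. [folklore] -/
theorem mem_boxPiece {n : ℕ} {z : ℝ × E} :
    z ∈ Icc (-((n : ℝ) + 1)) ((n : ℝ) + 1) ×ˢ closedBall (0 : E) ((n : ℝ) + 1) ↔
      (-((n : ℝ) + 1) ≤ z.1 ∧ z.1 ≤ (n : ℝ) + 1) ∧ ‖z.2‖ ≤ (n : ℝ) + 1 := by
  simp [mem_prod, mem_Icc, mem_closedBall, dist_zero_right]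

/-- The boxes `[−(n+1), n+1] × B̄(0, n+1)` are compact when `E` is proper. [folklore] -/
theorem isCompact_boxPiece [ProperSpace E] (n : ℕ) :
    IsCompact (Icc (-((n : ℝ) + 1)) ((n : ℝ) + 1) ×ˢ closedBall (0 : E) ((n : ℝ) + 1)) :=
  isCompact_Icc.prod (isCompact_closedBall _ _)

/-- **Every point of `ℝ × E` is interior to all large boxes.** [folklore] -/
theorem eventually_boxPiece_mem_nhds (t : ℝ) (x : E) :
    ∀ᶠ n : ℕ in atTop,
      Icc (-((n : ℝ) + 1)) ((n : ℝ) + 1) ×ˢ closedBall (0 : E) ((n : ℝ) + 1) ∈ 𝓝 (t, x) := by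
  have h1 : ∀ᶠ n : ℕ in atTop, |t| + 1 ≤ (n : ℝ) := tendsto_natCast_atTop_atTop.eventually_ge_atTop _
  have h3 : ∀ᶠ n : ℕ in atTop, ‖x‖ + 1 ≤ (n : ℝ) := tendsto_natCast_atTop_atTop.eventually_ge_atTop _
  filter_upwards [h1, h3] with n hn1 hn3
  have habs := abs_le.1 (show |t| ≤ (n : ℝ) - 1 by linarith)
  have hbox : Ioo (t - 1) (t + 1) ×ˢ ball x 1 ⊆
      Icc (-((n : ℝ) + 1)) ((n : ℝ) + 1) ×ˢ closedBall (0 : E) ((n : ℝ) + 1) := by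
    intro z hz
    obtain ⟨⟨hz1, hz2⟩, hz3⟩ := hz
    rw [mem_ball] at hz3
    refine mem_boxPiece.2 ⟨⟨by linarith [habs.1], by linarith [habs.2]⟩, ?_⟩
    calc ‖z.2‖ ≤ ‖x‖ + dist z.2 x := by
          have := norm_le_norm_add_norm_sub' z.2 x
          rwa [← dist_eq_norm] at this
      _ ≤ (n : ℝ) + 1 := by linarith
  refine Filter.mem_of_superset ?_ hbox
  exact prod_mem_nhds (Ioo_mem_nhds (by linarith) (by linarith)) (ball_mem_nhds x one_pos)

/-- Every point of `ℝ × E` lies in some box. [folklore] -/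
theorem exists_mem_boxPiece (t : ℝ) (x : E) :
    ∃ n : ℕ, (t, x) ∈ Icc (-((n : ℝ) + 1)) ((n : ℝ) + 1) ×ˢ closedBall (0 : E) ((n : ℝ) + 1) := by
  obtain ⟨n, hn⟩ := (eventually_boxPiece_mem_nhds t x).exists
  exact ⟨n, mem_of_mem_nhds hn⟩

variable {Y : Type*} [UniformSpace Y]

/-- **Continuity of the limit** of maps converging uniformly on every box along eventually
continuous maps. [folklore] -/
theorem continuous_of_tendstoUniformlyOn_boxPiece {ι : Type*} {p : Filter ι} [p.NeBot]
    {V : ι → ℝ × E → Y} {W : ℝ × E → Y}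
    (hV : ∀ n : ℕ, ∀ᶠ j in p, ContinuousOn (V j)
      (Icc (-((n : ℝ) + 1)) ((n : ℝ) + 1) ×ˢ closedBall (0 : E) ((n : ℝ) + 1)))
    (hW : ∀ n : ℕ, TendstoUniformlyOn V W p
      (Icc (-((n : ℝ) + 1)) ((n : ℝ) + 1) ×ˢ closedBall (0 : E) ((n : ℝ) + 1))) :
    Continuous W := by
  rw [continuous_iff_continuousAt]
  rintro ⟨t, x⟩
  obtain ⟨n, hn⟩ := (eventually_boxPiece_mem_nhds (E := E) t x).exists
  have hc : ContinuousOn W _ := (hW n).continuousOn (hV n).frequently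
  exact hc.continuousAt hn

/-- **Pointwise convergence** from uniform convergence on the boxes. [folklore] -/
theorem tendsto_of_tendstoUniformlyOn_boxPiece {ι : Type*} {p : Filter ι}
    {V : ι → ℝ × E → Y} {W : ℝ × E → Y}
    (hW : ∀ n : ℕ, TendstoUniformlyOn V W p
      (Icc (-((n : ℝ) + 1)) ((n : ℝ) + 1) ×ˢ closedBall (0 : E) ((n : ℝ) + 1)))
    (t : ℝ) (x : E) :
    Tendsto (fun j => V j (t, x)) p (𝓝 (W (t, x))) := by
  obtain ⟨n, hn⟩ := exists_mem_boxPiece (E := E) t x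
  exact (hW n).tendsto_at hn

/-- A compact set of the form `{t} × K`, `K` compact, lies in some box. [folklore] -/
theorem exists_singleton_prod_subset_boxPiece (t : ℝ) {K : Set E} (hK : IsCompact K) :
    ∃ n : ℕ, ({t} : Set ℝ) ×ˢ K ⊆
      Icc (-((n : ℝ) + 1)) ((n : ℝ) + 1) ×ˢ closedBall (0 : E) ((n : ℝ) + 1) := by
  obtain ⟨ρ, hρ⟩ := hK.isBounded.subset_closedBall 0
  have h1 : ∀ᶠ n : ℕ in atTop, |t| ≤ (n : ℝ) := tendsto_natCast_atTop_atTop.eventually_ge_atTop _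
  have h3 : ∀ᶠ n : ℕ in atTop, ρ ≤ (n : ℝ) := tendsto_natCast_atTop_atTop.eventually_ge_atTop _
  obtain ⟨n, hn1, hn3⟩ := (h1.and h3).exists
  have habs := abs_le.1 hn1
  refine ⟨n, fun z hz => ?_⟩
  obtain ⟨hz1, hz2⟩ := hz
  rw [mem_singleton_iff] at hz1
  have hz3 : ‖z.2‖ ≤ ρ := by simpa [mem_closedBall, dist_zero_right] using hρ hz2
  exact mem_boxPiece.2 ⟨⟨by rw [hz1]; linarith, by rw [hz1]; linarith⟩, hz3.trans (by linarith)⟩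

/-- **Slice-wise locally uniform convergence** from uniform convergence on the boxes (`E` proper,
so locally uniform convergence is uniform convergence on compact sets, and `{t} × K` lies in a
box). [folklore] -/
theorem tendstoLocallyUniformly_slice_of_tendstoUniformlyOn_boxPiece [ProperSpace E] {ι : Type*}
    {p : Filter ι} {V : ι → ℝ × E → Y} {W : ℝ × E → Y}
    (hW : ∀ n : ℕ, TendstoUniformlyOn V W p
      (Icc (-((n : ℝ) + 1)) ((n : ℝ) + 1) ×ˢ closedBall (0 : E) ((n : ℝ) + 1)))
    (t : ℝ) :
    TendstoLocallyUniformly (fun j x => V j (t, x)) (fun x => W (t, x)) p := by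
  rw [tendstoLocallyUniformly_iff_forall_isCompact]
  intro K hK
  obtain ⟨n, hn⟩ := exists_singleton_prod_subset_boxPiece (E := E) t hK
  have h := (hW n).mono hn
  -- transport along the embedding `x ↦ (t, x)`
  rw [tendstoUniformlyOn_iff_tendsto] at h ⊢
  have hmap : Tendsto (fun q : ι × E => (q.1, (t, q.2))) (p ×ˢ 𝓟 K) (p ×ˢ 𝓟 (({t} : Set ℝ) ×ˢ K)) := by
    refine Tendsto.prodMk tendsto_fst ?_
    have : Tendsto (fun q : ι × E => (t, q.2)) (p ×ˢ 𝓟 K) (𝓟 (({t} : Set ℝ) ×ˢ K)) := by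
      rw [tendsto_principal]
      filter_upwards [tendsto_snd (f := p) (g := 𝓟 K) (mem_principal_self K)] with q hq
      exact ⟨mem_singleton t, hq⟩
    exact this
  exact h.comp hmap

end Box

/-! ### Registered tools stub -/

/-- **Registered tools stub of the line `Sketch` (crux `TypeIliouvilleNoTypeII`,
stmt-NavierStokesRegularity-0056)**: the box-exhaustion toolkit over `E = ℝ³` along `atTop : Filter ℕ`
— compactness of the boxes, continuity of uniform-on-boxes limits, pointwise and slice-wise locally
uniform convergence. [folklore] -/
theorem stub_activeWindowsBoxesTools :
    (∀ n : ℕ, IsCompact (Icc (-((n : ℝ) + 1)) ((n : ℝ) + 1) ×ˢ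
      closedBall (0 : EuclideanSpace ℝ (Fin 3)) ((n : ℝ) + 1))) ∧
    (∀ (Y : Type) [UniformSpace Y] (V : ℕ → ℝ × EuclideanSpace ℝ (Fin 3) → Y)
      (W : ℝ × EuclideanSpace ℝ (Fin 3) → Y),
      (∀ n : ℕ, ∀ᶠ j in atTop, ContinuousOn (V j)
        (Icc (-((n : ℝ) + 1)) ((n : ℝ) + 1) ×ˢ closedBall (0 : EuclideanSpace ℝ (Fin 3)) ((n : ℝ) + 1))) →
      (∀ n : ℕ, TendstoUniformlyOn V W atTop
        (Icc (-((n : ℝ) + 1)) ((n : ℝ) + 1) ×ˢ closedBall (0 : EuclideanSpace ℝ (Fin 3)) ((n : ℝ) + 1))) →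
      Continuous W) ∧
    (∀ (Y : Type) [UniformSpace Y] (V : ℕ → ℝ × EuclideanSpace ℝ (Fin 3) → Y)
      (W : ℝ × EuclideanSpace ℝ (Fin 3) → Y),
      (∀ n : ℕ, TendstoUniformlyOn V W atTop
        (Icc (-((n : ℝ) + 1)) ((n : ℝ) + 1) ×ˢ closedBall (0 : EuclideanSpace ℝ (Fin 3)) ((n : ℝ) + 1))) →
      ∀ (t : ℝ) (x : EuclideanSpace ℝ (Fin 3)), Tendsto (fun j => V j (t, x)) atTop (𝓝 (W (t, x)))) ∧
    (∀ (Y : Type) [UniformSpace Y] (V : ℕ → ℝ × EuclideanSpace ℝ (Fin 3) → Y)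
      (W : ℝ × EuclideanSpace ℝ (Fin 3) → Y),
      (∀ n : ℕ, TendstoUniformlyOn V W atTop
        (Icc (-((n : ℝ) + 1)) ((n : ℝ) + 1) ×ˢ closedBall (0 : EuclideanSpace ℝ (Fin 3)) ((n : ℝ) + 1))) →
      ∀ t : ℝ, TendstoLocallyUniformly (fun j x => V j (t, x)) (fun x => W (t, x)) atTop) :=
  ⟨fun n => isCompact_boxPiece n,
    fun _ _ _ _ hV hW => continuous_of_tendstoUniformlyOn_boxPiece hV hW,
    fun _ _ _ _ hW t x => tendsto_of_tendstoUniformlyOn_boxPiece hW t x,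
    fun _ _ _ _ hW t => tendstoLocallyUniformly_slice_of_tendstoUniformlyOn_boxPiece hW t⟩

end Summit.NavierStokesRegularity.NavierStokesRegularity.Theorems.TypeIliouvilleNoTypeII.ImmortalZoom

end
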